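import Summits.QuantumFields.YangMills.Theorems.BalabanUVNodesN18KingModel
import Summits.QuantumFields.YangMills.Theorems.UnitScaleTiltFluctuationComparisonRegPrTwoCutoffOperatorHeightFree
import HarnessLib

/-!
# `UnitScaleTiltFluctuationComparisonRegPrTwoCutoffMinimiserHeightFree` — THE HEIGHT-FREE REFERENCE OBJECT OF THE K1a ROW AT THE MINIMISER LAYER:
# King's minimiser kernels `ℋ_k = a_kG^η_kQ^*_k` CONVERGE along every coherent tower of fine points, with the per-run rate `C₅·(L^k)^{−γ}`, ONE constant
# for all `k` (crux `FluctuationComparisonRegPrIntL`, stmt-QuantumFields-20520, STUB 3⁗χ; cell `pub/ym-inputs`, INPUT-LIST I-11 row p10 «K-uniform two-cut-off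
# propagator estimate behind `FlatKernelLegCauchyΦ`»; seat ym-inputs-p10 g5, count-neutral helper, def-free; desk word ym-inputs-plan-1 g10 2026-08-28T11:41:45Z «ONE file»)

WHY.  The two-run K1a row is supplied BY NAME through the per-run REFERENCE form against height-free reference objects (`KerHeightFree`, (R1) `KernelRefOwnΦ`;
`…GlobalSlackKernelLegRef(Own)`), i.e. [King1986]'s mechanism «each run's `k`-step objects are within `L^{−γk}` of the `n → ∞` limit objects» (p.657: «{Z^{ε_K}} is a
Cauchy sequence»).  On the flat `A = 0` template the lineage constructed the reference objects at the symbol, operator and covariance layers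
(`TwoCutoffSymbolHeightFree.exists_heightFree_limit`, `TwoCutoffOperatorHeightFree.exists_heightFree_operator`, `TwoCutoffCovarianceHeightFree.exists_heightFree_covariance`).
The one layer left was King's MINIMISER kernel `ℋ_k(x, b)` (Prop. 3.8 (3.71), first line; tree: `King1986.Torus.king_prop38_torus`, a TWO-RUN statement whose constant
`C₁(k, n) + C₂` carries `θ = lemma43Const a L k n`).  The `(k, n)`-free majorant of that constant is ALREADY a tree theorem — `BalabanUVNodes.N18KingModel.prop38Const_le_unif`
(ONE `C₅(a, L, d, γ)` for all `k, n ≥ 1`) — so the two-run row is uniform in `n` and the limit exists by completeness of `ℝ`.  This file records exactly that: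

* §1 coherent towers of fine points `x_k ∈ T_{L^{−k}}` (`x_k = ⌊x_{k+1}∕L⌋` coordinatewise): `val_eq_div_pow` (`x_k = ⌊x_{k+n}∕L^n⌋`);
* §2 the spelling transport `fine (L^n·L^k) M` vs `fine (L^{k+n}) M` of a fine point and of the minimiser (`val_respell`, `minimiser_respell` — `NeZero` is a `Prop`);
* §3 ★`abs_sub_le_unif` — `|ℋ_{k+n}(x_{k+n}, b) − ℋ_k(x_k, b)| ≤ C₅·(L^k)^{−γ}` for ALL `k, n ≥ 1`, `0 ≤ γ ≤ 1`, every volume `M`, every mass `m² > 0`, read along the tower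
  (= `king_prop38_torus` ∘ `prop38Const_le_unif`, nothing else);
* §4 ★★`exists_heightFree_minimiser` — for `0 < γ ≤ 1`: `∃ h∞, ℋ_k(x_k, b) → h∞` and the PER-RUN RATE `|ℋ_k(x_k, b) − h∞| ≤ C₅·(L^k)^{−γ}` for EVERY `k ≥ 1`; `heightFree_unique`;
  `abs_heightFree_le` — the reference inherits King's uniform size bound `(π∕2)^d[(π²∕4)^{d+1} + a(π²∕4)C(d, −1)]` (`abs_kernel_le_unif`);
* §5 `abs_sub_le_of_heightFree` — the two-run row RECOVERED from the reference form (triangle inequality, budget doubled), the pattern of `flatKernelLegCauchyΦ_of_ref`.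

HONEST FRAMING.  A limit theorem about the FLAT, ABELIAN, `A = 0` template objects of [King1986] §4 (the tree's `King1986/*`, cell pub-balaban; the uniform constant is the
N18 lineage's), i.e. King's scalar block-spin minimiser kernels on a unit torus; it is NOT the non-abelian `d = 3` statement behind `FlatKernelLegCauchyΦ` (Bałaban's
`G_k(Ω; U₀)` at a curved background — INPUT-LIST I-11 flag, KILL-TEST E2 = NO; the T³ letter `GT = (Δ_x(U₀) + D R_S D* + Q*aQ)⁻¹` of `…SectET3CurvedPropagatorsT3` is not King's
scalar `minimiser`), and it touches neither the stub, the crux, nor the (α) record.  Not reproduced: the exponential decay of the reference in the unit-torus distance (it follows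
the same way from `King1986.Torus.minimiser_kernel_decay_blocks_unif`, whose `Params` plumbing is not repeated here).  Nothing of [Balaban1985UV3] ∕ [King1986] is asserted
beyond the tree's PROVED `king_prop38_torus`, `abs_kernel_le_unif`, `prop38Const_le_unif`.  YM₃ on T³ (route `UnitScaleTilt`) is a ladder rung (R3, RECORD), not the Clay problem,
not 𝕋⁴, not a mass gap; no summit or sub-problem statement is proved here.

References: C. King, CMP 102 (1986) 649–677 [King1986] (Prop. 3.8 (3.71) p.664, (4.19)–(4.31) pp.672–674, Lemma 4.3 (4.18) p.672, (2.13) p.653; p.657 «Hence {Z^{ε_K}} is a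
Cauchy sequence and converges to a unique limit»; p.665 «Proposition 3.8 gives the desired factor L^{−γk}»).
-/

set_option autoImplicit false

noncomputable section

open Filter Topology Real
open Literature.MathematicalPhysics.QuantumFieldTheory.Balaban1983to89.B5Prop11Plancherel (Tor fine)
open Literature.MathematicalPhysics.QuantumFieldTheory.King1986 (aK lemma43Const prop38RateConst prop38PosConst aliasConst)
open Literature.MathematicalPhysics.QuantumFieldTheory.King1986.Torus (minimiser king_prop38_torus)
open Summit.QuantumFields.YangMills.BalabanUVNodes.N18KingModel
  (prop38Const_le_unif prop38Const_unif_nonneg rpow_neg_natPow kingTheta_lt_one abs_kernel_le_unif)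
open Summit.QuantumFields.YangMills.Theorems.TwoCutoffOperatorHeightFree (exists_limit_of_uniform_cauchy)

namespace Summit.QuantumFields.YangMills.Theorems.TwoCutoffMinimiserHeightFree

variable {d : ℕ}

/-! ## §1 Coherent towers of fine points -/

/-- Along a coherent tower (`x_k = ⌊x_{k+1}∕L⌋` coordinatewise) the level-`k` point is the `L^n`-block of the level-`k+n` point: `x_k = ⌊x_{k+n}∕L^n⌋`.
[cite: King1986, (4.1)–(4.3) p.670] -/
theorem val_eq_div_pow {L : ℕ} [NeZero L] {M : Fin d → ℕ} [∀ μ, NeZero (M μ)] (x : (k : ℕ) → Tor (fine (L ^ k) M))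
    (hx : ∀ k μ, (x k μ).val = (x (k + 1) μ).val / L) (k n : ℕ) (μ : Fin d) :
    (x k μ).val = (x (k + n) μ).val / L ^ n := by
  induction n with
  | zero => simp
  | succ n ih => rw [ih, hx (k + n) μ, Nat.div_div_eq_div_mul, ← pow_succ', ← Nat.add_assoc]

/-! ## §2 Respelling the fine torus: `fine (L^n·L^k) M` versus `fine (L^{k+n}) M` -/

/-- Respelling a fine point along an equality of spacings `N = N′` keeps its integer coordinates. [folklore] -/
theorem val_respell {N N' : ℕ} [NeZero N] [NeZero N'] {M : Fin d → ℕ} [∀ μ, NeZero (M μ)] (e : N = N') (x : Tor (fine N M))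
    (μ : Fin d) : ((((x μ).val : ℕ) : ZMod (fine N' M μ))).val = (x μ).val := by
  subst e
  rw [ZMod.natCast_zmod_val]

/-- Respelling the spacing `N = N′` does not change King's minimiser kernel read at the respelled point (`NeZero N` is a proposition, so the two instances agree).
[cite: King1986, (2.13)–(2.15) p.653] -/
theorem minimiser_respell {N N' : ℕ} [NeZero N] [NeZero N'] {M : Fin d → ℕ} [∀ μ, NeZero (M μ)] (e : N = N') (a m2 : ℝ)
    (φ : Tor M → ℝ) (x : Tor (fine N M)) :
    minimiser N' M a (((N' : ℕ) : ℝ) ^ 2) m2 φ (fun μ => (((x μ).val : ℕ) : ZMod (fine N' M μ)))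
      = minimiser N M a (((N : ℕ) : ℝ) ^ 2) m2 φ x := by
  subst e
  have hx : (fun μ => (((x μ).val : ℕ) : ZMod (fine N M μ))) = x := funext fun μ => ZMod.natCast_zmod_val (x μ)
  rw [hx]

/-! ## §3 The two-run row with ONE constant, read along a coherent tower -/

/-- **PROP. 3.8 (3.71), FIRST LINE, WITH ONE CONSTANT FOR ALL `k, n ≥ 1`, ALONG A COHERENT TOWER.**  For `L` odd, `L ≥ 2`, `a > 0`, `m² > 0`, `0 ≤ γ ≤ 1`, any unit torus
`M`, unit site `b` and coherent tower `x`:  `|ℋ_{k+n}(x_{k+n}, b) − ℋ_k(x_k, b)| ≤ C₅(a, L, d, γ)·(L^k)^{−γ}`, `ℋ_j = minimiser (L^j) M a_j (L^{2j}) m² δ_b`,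
`C₅ = prop38RateConst a a Θ (π²∕4)^d d γ + prop38PosConst a (π²∕4)^d d γ`, `Θ = 2a((a(1 − L⁻²))⁻¹ + π²∕48 + 1∕3)` — the tree's `king_prop38_torus` (run B respelled on
`fine (L^n·L^k) M`) with its constant majorised by `N18KingModel.prop38Const_le_unif`. [cite: King1986, Prop. 3.8 (3.71) p.664; Lemma 4.3 (4.18) p.672; (2.13) p.653] -/
theorem abs_sub_le_unif (hd : 0 < d) {L : ℕ} [NeZero L] (hLodd : Odd L) (hL : 2 ≤ L) (M : Fin d → ℕ) [∀ μ, NeZero (M μ)]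
    {a m2 : ℝ} (ha : 0 < a) (hm : 0 < m2) {γ : ℝ} (hγ0 : 0 ≤ γ) (hγ1 : γ ≤ 1) (b : Tor M)
    (x : (k : ℕ) → Tor (fine (L ^ k) M)) (hx : ∀ k μ, (x k μ).val = (x (k + 1) μ).val / L) {k n : ℕ} (hk : 1 ≤ k) (hn : 1 ≤ n) :
    |minimiser (L ^ (k + n)) M (aK a L (k + n)) (((L ^ (k + n) : ℕ) : ℝ) ^ 2) m2 (Pi.single b 1) (x (k + n))
        - minimiser (L ^ k) M (aK a L k) (((L ^ k : ℕ) : ℝ) ^ 2) m2 (Pi.single b 1) (x k)|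
      ≤ (prop38RateConst a a (a * (2 * ((a * (1 - ((L : ℝ) ^ 2)⁻¹))⁻¹ + π ^ 2 / 48 + 1 / 3))) ((π ^ 2 / 4) ^ d) d γ
          + prop38PosConst a ((π ^ 2 / 4) ^ d) d γ) * ((L ^ k : ℕ) : ℝ) ^ (-γ) := by
  have e : L ^ (k + n) = L ^ n * L ^ k := by rw [pow_add, mul_comm]
  -- run B's point respelled on `fine (L^n·L^k) M`
  set x' : Tor (fine (L ^ n * L ^ k) M) := fun μ => (((x (k + n) μ).val : ℕ) : ZMod (fine (L ^ n * L ^ k) M μ)) with hx'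
  have hxx' : ∀ μ, (x k μ).val = (x' μ).val / L ^ n := fun μ => by
    rw [hx', val_respell e (x (k + n)) μ]
    exact val_eq_div_pow x hx k n μ
  have hK := king_prop38_torus hd hLodd hL hk hn M ha hm hγ0 hγ1 b (x k) x' hxx'
  rw [hx', minimiser_respell e] at hK
  refine hK.trans (mul_le_mul_of_nonneg_right (prop38Const_le_unif hd ha hL hk hn (by linarith)) ?_)
  exact Real.rpow_nonneg (Nat.cast_nonneg _) _

/-! ## §4 The height-free reference minimiser kernel along a coherent tower -/

/-- **THE HEIGHT-FREE REFERENCE AT THE MINIMISER LAYER.**  For `L` odd, `L ≥ 2`, `a > 0`, `m² > 0`, `0 < γ ≤ 1`, any unit torus `M`, unit site `b` and coherent tower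
`x` of fine points there is ONE real number `h∞ = ℋ_∞(x, b)` with `ℋ_k(x_k, b) → h∞` and the PER-RUN RATE `|ℋ_k(x_k, b) − h∞| ≤ C₅(a, L, d, γ)·(L^k)^{−γ}` for EVERY
`k ≥ 1` — King's p.657 «{Z^{ε_K}} is a Cauchy sequence» at the kernel level: the two-run row §3 is uniform in `n`, `(L^k)^{−γ} = (L^{−γ})^k` with `L^{−γ} < 1`, and `ℝ` is
complete (`TwoCutoffOperatorHeightFree.exists_limit_of_uniform_cauchy`). [cite: King1986, Prop. 3.8 (3.71) p.664, p.657, p.665] -/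
theorem exists_heightFree_minimiser (hd : 0 < d) {L : ℕ} [NeZero L] (hLodd : Odd L) (hL : 2 ≤ L) (M : Fin d → ℕ) [∀ μ, NeZero (M μ)]
    {a m2 : ℝ} (ha : 0 < a) (hm : 0 < m2) {γ : ℝ} (hγ0 : 0 < γ) (hγ1 : γ ≤ 1) (b : Tor M)
    (x : (k : ℕ) → Tor (fine (L ^ k) M)) (hx : ∀ k μ, (x k μ).val = (x (k + 1) μ).val / L) :
    ∃ h : ℝ, Tendsto (fun k => minimiser (L ^ k) M (aK a L k) (((L ^ k : ℕ) : ℝ) ^ 2) m2 (Pi.single b 1) (x k)) atTop (𝓝 h)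
      ∧ ∀ k : ℕ, 1 ≤ k →
        |minimiser (L ^ k) M (aK a L k) (((L ^ k : ℕ) : ℝ) ^ 2) m2 (Pi.single b 1) (x k) - h|
          ≤ (prop38RateConst a a (a * (2 * ((a * (1 - ((L : ℝ) ^ 2)⁻¹))⁻¹ + π ^ 2 / 48 + 1 / 3))) ((π ^ 2 / 4) ^ d) d γ
              + prop38PosConst a ((π ^ 2 / 4) ^ d) d γ) * ((L ^ k : ℕ) : ℝ) ^ (-γ) := by
  refine exists_limit_of_uniform_cauchy (r := (L : ℝ) ^ (-γ))
    (C := prop38RateConst a a (a * (2 * ((a * (1 - ((L : ℝ) ^ 2)⁻¹))⁻¹ + π ^ 2 / 48 + 1 / 3))) ((π ^ 2 / 4) ^ d) d γ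
      + prop38PosConst a ((π ^ 2 / 4) ^ d) d γ)
    (kingTheta_lt_one hL hγ0) (fun k _ => by rw [rpow_neg_natPow]) fun k n hk hn => ?_
  rw [abs_sub_comm]
  exact abs_sub_le_unif hd hLodd hL M ha hm hγ0.le hγ1 b x hx hk hn

/-- The reference value is UNIQUE (limits in `ℝ` are unique): the height-free object is determined by the tower, not by any choice. [folklore] -/
theorem heightFree_unique {L : ℕ} [NeZero L] (M : Fin d → ℕ) [∀ μ, NeZero (M μ)] {a m2 : ℝ} (b : Tor M)
    (x : (k : ℕ) → Tor (fine (L ^ k) M)) {h h' : ℝ}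
    (hh : Tendsto (fun k => minimiser (L ^ k) M (aK a L k) (((L ^ k : ℕ) : ℝ) ^ 2) m2 (Pi.single b 1) (x k)) atTop (𝓝 h))
    (hh' : Tendsto (fun k => minimiser (L ^ k) M (aK a L k) (((L ^ k : ℕ) : ℝ) ^ 2) m2 (Pi.single b 1) (x k)) atTop (𝓝 h')) :
    h = h' :=
  tendsto_nhds_unique hh hh'

/-- The reference inherits KING'S UNIFORM SIZE BOUND: `|ℋ_∞(x, b)| ≤ (π∕2)^d[(π²∕4)^{d+1} + a(π²∕4)C(d, −1)]` (every `ℋ_k`, `k ≥ 1`, obeys it — `N18KingModel.abs_kernel_le_unif`,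
`a_k ≤ a` — and the bound is closed). [cite: King1986, Prop. 3.7 ∕ Thm 3.3 (size half) p.664, (4.22) p.672] -/
theorem abs_heightFree_le (hd : 0 < d) {L : ℕ} [NeZero L] (hLodd : Odd L) (hL : 2 ≤ L) (M : Fin d → ℕ) [∀ μ, NeZero (M μ)]
    {a m2 : ℝ} (ha : 0 < a) (hm : 0 < m2) (b : Tor M) (x : (k : ℕ) → Tor (fine (L ^ k) M)) {h : ℝ}
    (hh : Tendsto (fun k => minimiser (L ^ k) M (aK a L k) (((L ^ k : ℕ) : ℝ) ^ 2) m2 (Pi.single b 1) (x k)) atTop (𝓝 h)) :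
    |h| ≤ (π / 2) ^ d * ((π ^ 2 / 4) ^ d * (π ^ 2 / 4) + a * (π ^ 2 / 4) * aliasConst d (-1)) := by
  refine le_of_tendsto ((continuous_abs.tendsto h).comp hh) ?_
  filter_upwards [eventually_ge_atTop 1] with k hk
  exact abs_kernel_le_unif hd hL (hLodd.pow) (Nat.one_le_pow k L (by omega)) hk M ha hm b (x k)

/-! ## §5 Two runs from the reference -/

/-- **TWO RUNS FROM THE REFERENCE**: the per-run rows against `ℋ_∞` give back a two-run row with the doubled budget `2C₅·(L^k)^{−γ}` (`(L^{k′})^{−γ} ≤ (L^k)^{−γ}` for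
`k ≤ k′`) — nothing is lost by recording only the reference form (the pattern of `GlobalSlackKernelLeg.flatKernelLegCauchyΦ_of_ref`). [cite: King1986, Prop. 3.6 (3.56) p.662] -/
theorem abs_sub_le_of_heightFree {L : ℕ} (hL : 2 ≤ L) {γ C : ℝ} (hγ : 0 ≤ γ) (hC : 0 ≤ C) {s : ℕ → ℝ} {h : ℝ}
    (hs : ∀ k : ℕ, 1 ≤ k → |s k - h| ≤ C * ((L ^ k : ℕ) : ℝ) ^ (-γ)) {k k' : ℕ} (hk : 1 ≤ k) (hkk' : k ≤ k') :
    |s k' - s k| ≤ 2 * C * ((L ^ k : ℕ) : ℝ) ^ (-γ) := by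
  have hL1 : (1 : ℝ) ≤ L := by exact_mod_cast (show 1 ≤ L by omega)
  have hmono : ((L ^ k' : ℕ) : ℝ) ^ (-γ) ≤ ((L ^ k : ℕ) : ℝ) ^ (-γ) := by
    rw [rpow_neg_natPow, rpow_neg_natPow]
    exact pow_le_pow_of_le_one (Real.rpow_nonneg (by positivity) _)
      (Real.rpow_le_one_of_one_le_of_nonpos hL1 (by linarith)) hkk'
  calc |s k' - s k| = |(s k' - h) - (s k - h)| := by ring_nf
    _ ≤ |s k' - h| + |s k - h| := abs_sub _ _
    _ ≤ C * ((L ^ k' : ℕ) : ℝ) ^ (-γ) + C * ((L ^ k : ℕ) : ℝ) ^ (-γ) := add_le_add (hs k' (hk.trans hkk')) (hs k hk)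
    _ ≤ C * ((L ^ k : ℕ) : ℝ) ^ (-γ) + C * ((L ^ k : ℕ) : ℝ) ^ (-γ) := by gcongr
    _ = 2 * C * ((L ^ k : ℕ) : ℝ) ^ (-γ) := by ring

end Summit.QuantumFields.YangMills.Theorems.TwoCutoffMinimiserHeightFree

end
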